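import Summits.AtomisticToContinuum.FouriersLaw.Theorems.EmbeddedDrudeMourreAbelThermodynamicLimitAnchoredDcLimitOfRegularity
import Summits.AtomisticToContinuum.FouriersLaw.Theorems.EmbeddedDrudeMourreAbelThermodynamicLimitAnchoredKuboUniformMixing
import Summits.AtomisticToContinuum.FouriersLaw.Theorems.EmbeddedDrudeMourreAbelThermodynamicLimitUniformMixing
import Summits.AtomisticToContinuum.FouriersLaw.Theorems.EmbeddedDrudeMourreAbelThermodynamicLimitFixedFrequencyMatching
import Summits.AtomisticToContinuum.FouriersLaw.Theorems.EmbeddedDrudeMourreAbelThermodynamicLimitRegularDLRUnique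
import Summits.AtomisticToContinuum.FouriersLaw.Theorems.EmbeddedDrudeMourreGreenKuboContinuationCanonicalSeedOfRegularState
import Literature.MathematicalPhysics.KineticTheory.InfiniteChainSuperstableOrbits
import Literature.MathematicalPhysics.KineticTheory.InfiniteChainTightRegular
import HarnessLib

/-!
# Stub NEC-R `stub_regularityAtOfRegularWitness` of line `loomis-compact-horizon-witness` (rev 5) — PROVED
(crux `EmbeddedDrudeMourre.AbelThermodynamicLimit`, item stmt-AtomisticToContinuum-12596; `--supports` file proving the
registered stub VERBATIM; closes nothing)

**Uniform Abelian regularity (R) at `T` is NECESSARY for every regular witness the crux could output.**  Write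
`P = pinnedChain ω₂ lam β γ` (all `> 0`), `T > 0`, `c_N(t) = ∫ J · P_t J dμ_{N,T}` (open `N`-chain, both baths at `T`),
`F_N(ν) = ∫₀^∞ e^{-νt} c_N`, `A_N(0) = Σ_k ∫₀^∞ ⟨j_{c_N}(0) j_k(t)⟩ dt` (anchored DC value).  IF `(μT, D', κ)` has a
shift-invariant DLR state `μT`, a `μT`-preserving dynamics `D'` with absolutely convergent correlations and Abel limit
`T⁻² ∫₀^∞ e^{-νt} C_{D'} → κ` (`ν ↓ 0`), and along SOME steady family with responses `Dn` at `T` one has `Dn → κ`, THEN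
`∀ ε > 0 ∃ ν₀ > 0 ∀ ν ∈ (0, ν₀) ∃ N₀ ∀ N ≥ N₀, |∫₀^∞ (1 - e^{-νt}) c_N(t) dt| ≤ ε N` — the body of
`StaticAbelianSqueeze.UniformAbelianRegularity` at these parameters and this `T`.

Proof (this file, sorry-free):
* §1 the real-variable converse of the landed `exists_tendsto_of_flat_abel`: `a_N → L`, `Ahat → L` at `0⁺` and
  `Φ_N(ν)/N → Ahat ν` give `|(N-1) a_N - Φ_N(ν)| ≤ εN` eventually, for all small `ν` (`eventually_flat_of_tendsto`);
* §2 regularisation of the dynamics: shift-invariant ⇒ one-site tight ⇒ superstable; `μT`-a.e. `D'`-orbit stays in `bmGood`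
  (`ae_forall_flow_mem_bmGood_pinnedChain`); restricting `D'` to those orbits (`exists_restrictOrbits`) keeps the flow, hence the
  correlations, and yields a regular pair to which (M) `stub_fixedFrequencyMatching` applies: `F_N(ν)/N → ∫₀^∞e^{-νt}C_{D'}`;
* §3 the stub: S3 (`stub_anchoredKuboOfUniformMixing` + `stub_uniformMixing`) gives `A_N(0) = T²·Dn N → T²κ`, the Abel clause
  gives `∫₀^∞e^{-νt}C_{D'} → T²κ`, §1 applies, and DC-flatness `∫₀^∞(1-e^{-νt})c_N = (N-1)A_N(0) - F_N(ν)`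
  (`integral_one_sub_exp_mul_autocorr`) rewrites its conclusion into the stub's.
References: Kundu–Dhar–Narayan 2009 (arXiv:0809.4543) eqs. (8)–(15); Bonetto–Lebowitz–Rey-Bellet 2000 §7 eq. (37). No definitions.
-/

noncomputable section

open MeasureTheory Filter Set
open scoped Topology NNReal BigOperators

namespace Summit.AtomisticToContinuum.FouriersLaw.Theorems.AbelThermodynamicLimit.LoomisCompactHorizonWitness

open Literature.MathematicalPhysics.KineticTheory.HeatConduction
open Summit.AtomisticToContinuum.FouriersLaw.Theorems.GreenKuboContinuation.TemperatureBlindVitaliHurwitz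
  (exists_restrictOrbits currentCorrelation_eq_of_flow_eq hasAbsConvergentCorrelation_iff_of_flow_eq
   preservesMeasure_of_flow_eq)

/-! ## §1 Real-variable converse: common limit ⇒ uniform flatness at small frequency -/

/-- If `a_N → L`, `Ahat ν → L` (`ν ↓ 0`) and `Φ_N(ν)/N → Ahat ν` for every `ν > 0`, then for every `ε > 0` there is
`ν₀ > 0` such that for all `ν ∈ (0, ν₀)`, eventually in `N`, `|(N-1) a_N - Φ_N(ν)| ≤ ε N`
(converse of `exists_tendsto_of_flat_abel`; bookkeeping
`(N-1)a_N - Φ_N(ν) = (N-1)(a_N - L) - L + N(L - Ahat ν) + (N·Ahat ν - Φ_N(ν))`). [folklore] -/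
theorem eventually_flat_of_tendsto {a : ℕ → ℝ} {Φ : ℕ → ℝ → ℝ} {Ahat : ℝ → ℝ} {L : ℝ}
    (ha : Tendsto a atTop (𝓝 L)) (hA : Tendsto Ahat (𝓝[>] 0) (𝓝 L))
    (h2 : ∀ ν : ℝ, 0 < ν → Tendsto (fun N : ℕ => Φ N ν / (N : ℝ)) atTop (𝓝 (Ahat ν))) :
    ∀ ε : ℝ, 0 < ε → ∃ ν₀ : ℝ, 0 < ν₀ ∧ ∀ ν : ℝ, 0 < ν → ν < ν₀ →
      ∀ᶠ N : ℕ in atTop, |((N : ℝ) - 1) * a N - Φ N ν| ≤ ε * N := by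
  intro ε hε
  have hε3 : 0 < ε / 3 := by positivity
  have hε6 : 0 < ε / 6 := by positivity
  obtain ⟨ν₀, hν₀, hν⟩ := Metric.tendsto_nhdsWithin_nhds.1 hA (ε / 3) hε3
  refine ⟨ν₀, hν₀, fun ν hν0 hνν₀ => ?_⟩
  -- `|Ahat ν - L| < ε/3`
  have hAν : |Ahat ν - L| < ε / 3 := by
    have h := hν (Set.mem_Ioi.2 hν0) (by rwa [Real.dist_eq, sub_zero, abs_of_pos hν0])
    rwa [Real.dist_eq] at h
  -- eventually `|a N - L| < ε/6`, `|Φ N ν / N - Ahat ν| < ε/3`, `|L| ≤ (ε/6) N`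
  have h1 : ∀ᶠ N : ℕ in atTop, |a N - L| < ε / 6 := by
    have := ha.eventually (Metric.ball_mem_nhds L hε6)
    filter_upwards [this] with N hN
    rwa [Real.dist_eq] at hN
  have h3 : ∀ᶠ N : ℕ in atTop, |Φ N ν / (N : ℝ) - Ahat ν| < ε / 3 := by
    have := (h2 ν hν0).eventually (Metric.ball_mem_nhds (Ahat ν) hε3)
    filter_upwards [this] with N hN
    rwa [Real.dist_eq] at hN
  have h4 : ∀ᶠ N : ℕ in atTop, |L| ≤ ε / 6 * (N : ℝ) := by
    have ht : Tendsto (fun N : ℕ => ε / 6 * (N : ℝ)) atTop atTop :=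
      Tendsto.const_mul_atTop hε6 tendsto_natCast_atTop_atTop
    exact ht.eventually (eventually_ge_atTop |L|)
  filter_upwards [h1, h3, h4, eventually_gt_atTop 0] with N hN1 hN3 hN4 hN0
  have hN' : (0 : ℝ) < N := by exact_mod_cast hN0
  have hN1' : (0 : ℝ) ≤ (N : ℝ) - 1 := by
    have : (1 : ℝ) ≤ N := by exact_mod_cast hN0
    linarith
  -- `|N · Ahat ν - Φ N ν| < (ε/3) N`
  have h3' : |(N : ℝ) * Ahat ν - Φ N ν| < ε / 3 * N := by
    have e : (N : ℝ) * Ahat ν - Φ N ν = -((N : ℝ) * (Φ N ν / N - Ahat ν)) := by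
      field_simp
      ring
    rw [e, abs_neg, abs_mul, abs_of_pos hN']
    calc (N : ℝ) * |Φ N ν / N - Ahat ν| < N * (ε / 3) := mul_lt_mul_of_pos_left hN3 hN'
      _ = ε / 3 * N := by ring
  have e : ((N : ℝ) - 1) * a N - Φ N ν =
      ((N : ℝ) - 1) * (a N - L) + (-L) + (N : ℝ) * (L - Ahat ν) + ((N : ℝ) * Ahat ν - Φ N ν) := by ring
  rw [e]
  calc |((N : ℝ) - 1) * (a N - L) + (-L) + (N : ℝ) * (L - Ahat ν) + ((N : ℝ) * Ahat ν - Φ N ν)|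
      ≤ |((N : ℝ) - 1) * (a N - L)| + |(-L)| + |(N : ℝ) * (L - Ahat ν)| + |(N : ℝ) * Ahat ν - Φ N ν| := by
        have h4t := abs_add_le (((N : ℝ) - 1) * (a N - L) + (-L) + (N : ℝ) * (L - Ahat ν))
          ((N : ℝ) * Ahat ν - Φ N ν)
        have h3t := abs_add_three (((N : ℝ) - 1) * (a N - L)) (-L) ((N : ℝ) * (L - Ahat ν))
        linarith
    _ ≤ ((N : ℝ) - 1) * (ε / 6) + ε / 6 * N + (N : ℝ) * (ε / 3) + ε / 3 * N := by
        have b1 : |((N : ℝ) - 1) * (a N - L)| ≤ ((N : ℝ) - 1) * (ε / 6) := by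
          rw [abs_mul, abs_of_nonneg hN1']
          exact mul_le_mul_of_nonneg_left hN1.le hN1'
        have b2 : |(-L)| ≤ ε / 6 * N := by rwa [abs_neg]
        have b3 : |(N : ℝ) * (L - Ahat ν)| ≤ (N : ℝ) * (ε / 3) := by
          rw [abs_mul, abs_of_pos hN', abs_sub_comm]
          exact mul_le_mul_of_nonneg_left hAν.le hN'.le
        have b4 : |(N : ℝ) * Ahat ν - Φ N ν| ≤ ε / 3 * N := h3'.le
        linarith
    _ ≤ ε * N := by nlinarith

/-! ## §2 Regularisation of the dynamics half of a witness with regular state -/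

/-- **Restriction of a `μT`-preserving dynamics to its `bmGood` orbits.** For `P` (`ω₂, lam, β > 0`), `T > 0`, a
shift-invariant DLR state `μT` is superstable, `μT`-a.e. orbit of any `μT`-preserving dynamics `D'` stays in `bmGood` at all
times, and `D'` restricted to those orbits is a dynamics with carrier `⊆ bmGood`, still `μT`-preserving, with the SAME
correlations (same flow). [cite: ButtaMarchioro2016, eq. (2.6)] -/
theorem exists_restrict_bmGood {ω₂ lam β γ T : ℝ} (hω : 0 < ω₂) (hl : 0 < lam) (hβ : 0 < β) (hT : 0 < T)
    {μT : Measure ChainConfig} (D' : InfiniteChainDynamics (pinnedChain ω₂ lam β γ))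
    (hG : (pinnedChain ω₂ lam β γ).IsChainGibbsMeasure T μT) (hS : IsShiftInvariant μT)
    (hP : D'.PreservesMeasure μT) :
    (pinnedChain ω₂ lam β γ).HasSuperstabilityEstimate μT ∧
    ∃ D : InfiniteChainDynamics (pinnedChain ω₂ lam β γ),
      D.carrier ⊆ (pinnedChain ω₂ lam β γ).bmGood ∧ D.PreservesMeasure μT ∧
      (∀ t : ℝ, D.HasAbsConvergentCorrelation μT t ↔ D'.HasAbsConvergentCorrelation μT t) ∧
      D.currentCorrelation μT = D'.currentCorrelation μT := by
  haveI : IsProbabilityMeasure μT := hG.isProbabilityMeasure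
  obtain ⟨-, hss⟩ :=
    OscillatorChain.isShiftInvariant_and_hasSuperstabilityEstimate_of_tight_pinnedChain γ hω hl.le hβ.le hT hG
      (oneSiteTight_of_isShiftInvariant hS)
  have horb : ∀ᵐ σ ∂μT, ∀ t : ℝ, D'.flow t σ ∈ (pinnedChain ω₂ lam β γ).bmGood :=
    OscillatorChain.ae_forall_flow_mem_bmGood_pinnedChain γ hω.le hl hβ hss D' hP
  obtain ⟨D, hcar, hflow⟩ := exists_restrictOrbits D' (pinnedChain ω₂ lam β γ).bmGood
  refine ⟨hss, D, ?_, ?_, fun t => hasAbsConvergentCorrelation_iff_of_flow_eq hflow μT t,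
    currentCorrelation_eq_of_flow_eq hflow μT⟩
  · intro σ hσ
    rw [hcar] at hσ
    have h0 := hσ.2 0
    rwa [D'.flow_zero σ hσ.1] at h0
  · refine preservesMeasure_of_flow_eq hflow ?_ hP
    rw [hcar]
    filter_upwards [hP.1, horb] with σ h1 h2 using ⟨h1, h2⟩

/-! ## §3 The registered stub NEC-R -/

/-- **Registered stub NEC-R `stub_regularityAtOfRegularWitness` of line `loomis-compact-horizon-witness` (rev 5) — (R) AT `T` IS
NECESSARY FOR EVERY REGULAR WITNESS WITH `Dn → κ`** (see the module docstring).
[cite: KunduDharNarayan2009, eqs. (8)–(15)] [cite: BonettoLebowitzReyBellet2000, §7 eq. (37)] -/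
theorem stub_regularityAtOfRegularWitness :
    ∀ ω₂ lam β γ : ℝ, 0 < ω₂ → 0 < lam → 0 < β → 0 < γ →
      (∀ (N : ℕ) (T_L T_R : ℝ), 0 < T_L → 0 < T_R →
        ∀ μ ν : MeasureTheory.Measure
            (Literature.MathematicalPhysics.KineticTheory.HeatConduction.PhaseSpace N),
          (Literature.MathematicalPhysics.KineticTheory.HeatConduction.pinnedChain
              ω₂ lam β γ).IsSteadyState N T_L T_R μ →
          (Literature.MathematicalPhysics.KineticTheory.HeatConduction.pinnedChain
              ω₂ lam β γ).IsSteadyState N T_L T_R ν → μ = ν) →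
      ∀ T : ℝ, 0 < T →
      ∀ (μT : MeasureTheory.Measure
            Literature.MathematicalPhysics.KineticTheory.HeatConduction.ChainConfig)
        (D' : Literature.MathematicalPhysics.KineticTheory.HeatConduction.InfiniteChainDynamics
          (Literature.MathematicalPhysics.KineticTheory.HeatConduction.pinnedChain ω₂ lam β γ))
        (κ : ℝ),
        (Literature.MathematicalPhysics.KineticTheory.HeatConduction.pinnedChain
            ω₂ lam β γ).IsChainGibbsMeasure T μT →
        Literature.MathematicalPhysics.KineticTheory.HeatConduction.IsShiftInvariant μT →
        D'.PreservesMeasure μT →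
        (∀ t : ℝ, D'.HasAbsConvergentCorrelation μT t) →
        Filter.Tendsto (fun ν : ℝ => (T ^ 2)⁻¹ *
            MeasureTheory.integral (MeasureTheory.volume.restrict (Set.Ioi (0:ℝ)))
              (fun t : ℝ => Real.exp (-(ν * t)) * D'.currentCorrelation μT t))
          (nhdsWithin (0:ℝ) (Set.Ioi 0)) (nhds κ) →
      ∀ (μ : (N : ℕ) → ℝ → ℝ → MeasureTheory.Measure
            (Literature.MathematicalPhysics.KineticTheory.HeatConduction.PhaseSpace N))
        (Dn : ℕ → ℝ),
        (∀ (N : ℕ) (T_L T_R : ℝ), 0 < T_L → 0 < T_R →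
          (Literature.MathematicalPhysics.KineticTheory.HeatConduction.pinnedChain
              ω₂ lam β γ).IsSteadyState N T_L T_R (μ N T_L T_R)) →
        (∀ N : ℕ, Filter.Tendsto (fun δ : ℝ =>
            (Literature.MathematicalPhysics.KineticTheory.HeatConduction.pinnedChain
                ω₂ lam β γ).totalCurrent (μ N (T + δ / 2) (T - δ / 2)) / δ)
          (nhdsWithin 0 {(0 : ℝ)}ᶜ) (nhds (Dn N))) →
        Filter.Tendsto Dn Filter.atTop (nhds κ) →
        ∀ ε : ℝ, 0 < ε → ∃ ν₀ : ℝ, 0 < ν₀ ∧ ∀ ν : ℝ, 0 < ν → ν < ν₀ → ∃ N₀ : ℕ, ∀ N : ℕ, N₀ ≤ N →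
          |∫ t in Set.Ioi (0:ℝ), (1 - Real.exp (-(ν * t))) *
              ∫ z, (∑ i : Fin N, (Literature.MathematicalPhysics.KineticTheory.HeatConduction.pinnedChain
                      ω₂ lam β γ).bondCurrent N i z) *
                (∫ y, (∑ i : Fin N, (Literature.MathematicalPhysics.KineticTheory.HeatConduction.pinnedChain
                      ω₂ lam β γ).bondCurrent N i y)
                  ∂((Literature.MathematicalPhysics.KineticTheory.HeatConduction.pinnedChain
                      ω₂ lam β γ).transitionKernel N T T t.toNNReal z))
                ∂((Literature.MathematicalPhysics.KineticTheory.HeatConduction.pinnedChain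
                      ω₂ lam β γ).gibbsMeasure N T)| ≤ ε * N := by
  intro ω₂ lam β γ hω hl hβ hγ hU T hT μT D' κ hG hS hP hAC hAbel μ Dn hμ hDn hconv
  have hT2 : (T ^ 2) ≠ 0 := pow_ne_zero 2 hT.ne'
  -- §2: regularise the dynamics half
  obtain ⟨hss, D, hcar, hPD, hACiff, hcorr⟩ := exists_restrict_bmGood hω hl hβ hT D' hG hS hP
  have hACD : ∀ t : ℝ, D.HasAbsConvergentCorrelation μT t := fun t => (hACiff t).2 (hAC t)
  -- (M) for the regular pair `(μT, D)`
  have hM := stub_fixedFrequencyMatching ω₂ lam β γ hω hl hβ hγ T hT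
    (stub_regularDLRUnique ω₂ lam β γ hω hl hβ hγ T hT) μT D hG hS hss hcar hPD hACD
  -- the Abel function of `D` (= that of `D'`) tends to `T² κ`
  have hA : Tendsto (fun ν : ℝ => ∫ t in Ioi (0 : ℝ),
      Real.exp (-(ν * t)) * D.currentCorrelation μT t) (𝓝[>] 0) (𝓝 (T ^ 2 * κ)) := by
    rw [hcorr]
    have h := hAbel.const_mul (T ^ 2)
    simp only [← mul_assoc, mul_inv_cancel₀ hT2, one_mul] at h
    exact h
  -- S3: `A_N(0) = T² Dn N` for `N ≥ 2`, hence `A(0) → T² κ`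
  have hKq : ∀ (N : ℕ) (hN : 2 ≤ N), T ^ 2 * Dn N = ∑ k : Fin N, ∫ t in Set.Ioi (0 : ℝ),
      ∫ z, (pinnedChain ω₂ lam β γ).bondCurrent N ⟨(N - 1) / 2, by omega⟩ z *
        (∫ y, (pinnedChain ω₂ lam β γ).bondCurrent N k y
          ∂((pinnedChain ω₂ lam β γ).transitionKernel N T T t.toNNReal z))
        ∂((pinnedChain ω₂ lam β γ).gibbsMeasure N T) := fun N hN =>
    (stub_anchoredKuboOfUniformMixing ω₂ lam β γ hω hl hβ hγ hU T hT μ Dn hμ hDn N hN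
      (stub_uniformMixing ω₂ lam β γ hω hl hβ hγ T hT N hN)).2
  have ha : Tendsto (fun N : ℕ => if hN : 2 ≤ N then
      ∑ k : Fin N, ∫ t in Set.Ioi (0 : ℝ),
        ∫ z, (pinnedChain ω₂ lam β γ).bondCurrent N ⟨(N - 1) / 2, by omega⟩ z *
          (∫ y, (pinnedChain ω₂ lam β γ).bondCurrent N k y
            ∂((pinnedChain ω₂ lam β γ).transitionKernel N T T t.toNNReal z))
        ∂((pinnedChain ω₂ lam β γ).gibbsMeasure N T) else 0) atTop (𝓝 (T ^ 2 * κ)) := by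
    refine (hconv.const_mul (T ^ 2)).congr' ?_
    filter_upwards [eventually_ge_atTop 2] with N hN
    rw [dif_pos hN]
    exact hKq N hN
  -- §1 applied, then DC-flatness
  intro ε hε
  obtain ⟨ν₀, hν₀, hν⟩ := eventually_flat_of_tendsto ha hA hM ε hε
  refine ⟨ν₀, hν₀, fun ν hν0 hνν₀ => ?_⟩
  obtain ⟨N₀, hN₀⟩ := ((hν ν hν0 hνν₀).and (eventually_ge_atTop 2)).exists_forall_of_atTop
  refine ⟨N₀, fun N hN => ?_⟩
  obtain ⟨hflat, hN2⟩ := hN₀ N hN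
  rw [dif_pos hN2] at hflat
  rw [integral_one_sub_exp_mul_autocorr hω hl hβ hγ hT hN2 hν0.le]
  exact hflat

end Summit.AtomisticToContinuum.FouriersLaw.Theorems.AbelThermodynamicLimit.LoomisCompactHorizonWitness

end
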